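import Summits.AtomisticToContinuum.BoseEinsteinCondensation.Theorems.BoxHorizonAffinityB
import Summits.AtomisticToContinuum.BoseEinsteinCondensation.Theorems.SoloBlindJensenAffinity
import HarnessLib

/-!
# «HorizonAffinity», Part III — the INFORMATION and TOLERANCE DOORS for lens-6's residual (decomp-a2c · lens-6 · g34)

Two proved lower bounds for the block-label affinity at every scale, and the two ATTACK LINES on the
residual LAB_h(η) they open:
* INFORMATION DOOR `exp_neg_div_two_le_labelAffinity_of_labelKL_le`:
  `labelAffinity L K Φ ≥ exp(−KL(joint ‖ P̂ ⊗ unif)/2)` (Jensen, `D_{1/2} ≤ KL`, from the tree's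
  `SoloBlindJensenAffinity` on `Lebesgue ⊗ counting`), with the conditional block-label relative entropy
  `labelKL` (`= I(label ; Y) + KL(law(label) ‖ unif)`); piece HKL(η) = `GroundStateHorizonLabelKL η`,
  `horizonLabelAffinity_of_labelKL : HKL(η) → LAB_h(η)`, kernel `bec_of_horizonKL₀`.
* TOLERANCE DOOR `labelAffinity_ge_of_fairShare`: if on a set `G` of environments every block carries
  `≥ γ ×` its fair share of particle 1's conditional law, then `labelAffinity ≥ √γ · P̂(G)`; piece FSH(η) =
  `GroundStateHorizonFairShare η` («one-particle insertion tolerance at the energy horizon»),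
  `horizonLabelAffinity_of_fairShare : FSH(η) → LAB_h(η)`, kernel `bec_of_horizonFairShare₀`.
Both pieces are STRONGER than the residual and mutually incomparable; LAB_h(η) stays the residual of
record.  See Part II (`BoxHorizonAffinity.lean`) for the node and Part I (`BoxLabelAffinity.lean`) for
the objects.
-/

noncomputable section

open MeasureTheory Filter Set
open scoped ENNReal NNReal BigOperators

/-! ## Part III — gen 34 addendum: the INFORMATION DOOR for the residual
`labelAffinity ≥ exp(−KL(joint ‖ P̂ ⊗ unif)/2)` (Jensen / Rényi-½ ≤ KL, tree `SoloBlindJensenAffinity`),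
at EVERY scale; hence the horizon-cell relative-entropy piece HKL(η) ⟹ LAB_h(η) (PROVED), and the
door-free kernel `UGS → LOC_h(η) → HKL(η) → BoseEinsteinCondensation`.  HKL is an ATTACK LINE for the
residual (STRONGER than LAB_h), written in the solo-blind line's information currency at the coarsest
(horizon-cell) resolution: by the chain rule `KL(joint ‖ P̂ ⊗ unif) = I(label ; Y) + KL(law(label) ‖ unif)`
and by data processing `I(label_h ; Y) ≤ I(label_GP ; Y) ≤ I(x₁ ; Y)` (the one-vs-rest mutual information of
`SoloBlindMutualInformation`), so HKL is the SMALLEST member of that family. -/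

namespace Summit.AtomisticToContinuum.BoseEinsteinCondensation.Theorems.BoxLabelAffinity

open MeasureTheory Filter Set InformationTheory
open scoped ENNReal NNReal BigOperators
open Literature.MathematicalPhysics.QuantumManyBody.BoseGas

variable {n : ℕ}

/-! ### §11  (environment, label) space, joint and product laws, conditional label entropy -/

/-- The reference measure on (environment, block-label) pairs `(Y, B)`: Lebesgue ⊗ counting. [folklore] -/
def labelSpace (n K : ℕ) : Measure (Config n × SubIdx K) :=
  (volume : Measure (Config n)).prod Measure.count

/-- Joint density of «the other `N−1` particles at `Y`, particle 1 in block `B`» under `Φ²`: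
`(Y, B) ↦ q_B(Y)`. [folklore] -/
def labelJoint (L : ℝ) (K : ℕ) (Φ : Config (n + 1) → ℝ) (ω : Config n × SubIdx K) : ℝ≥0∞ :=
  blockMass L K Φ ω.2 ω.1

/-- Product reference density `P̂ ⊗ unif_{K³}`: `(Y, B) ↦ P̂(Y)·K⁻³`. [folklore] -/
def labelRef (K : ℕ) (Φ : Config (n + 1) → ℝ) (ω : Config n × SubIdx K) : ℝ≥0∞ :=
  sliceSq Φ ω.1 * blockWeight K ^ 2

/-- **Conditional block-label relative entropy** `KL(joint ‖ P̂ ⊗ unif) = E_{Y∼P̂} KL(π(·|Y) ‖ unif_{K³})`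
(`= I(label(x₁) ; Y) + KL(law(label(x₁)) ‖ unif)` by the chain rule — the mutual information between
particle 1's BLOCK LABEL and the other particles, plus the non-uniformity of the one-body block law).
NEW OBJECT (information form of the residual). [folklore] -/
def labelKL (L : ℝ) (K : ℕ) (Φ : Config (n + 1) → ℝ) : ℝ≥0∞ :=
  klDiv ((labelSpace n K).withDensity (labelJoint L K Φ))
    ((labelSpace n K).withDensity (labelRef K Φ))

/-- The reverse relative entropy `KL(P̂ ⊗ unif ‖ joint) = E_{Y∼P̂} KL(unif_{K³} ‖ π(·|Y))`. [folklore] -/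
def labelKLRev (L : ℝ) (K : ℕ) (Φ : Config (n + 1) → ℝ) : ℝ≥0∞ :=
  klDiv ((labelSpace n K).withDensity (labelRef K Φ))
    ((labelSpace n K).withDensity (labelJoint L K Φ))

/-- Measurability of the joint label density `labelJoint`. [folklore] -/
theorem measurable_labelJoint (L : ℝ) (K : ℕ) {Φ : Config (n + 1) → ℝ} (hΦm : Measurable Φ) :
    Measurable (labelJoint (n := n) L K Φ) :=
  measurable_from_prod_countable_left fun B => measurable_blockMass L K hΦm B

/-- Measurability of the reference label density `labelRef`. [folklore] -/
theorem measurable_labelRef (K : ℕ) {Φ : Config (n + 1) → ℝ} (hΦm : Measurable Φ) :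
    Measurable (labelRef (n := n) K Φ) :=
  measurable_from_prod_countable_left fun _ => (measurable_sliceSq hΦm).mul_const _

/-- Tonelli on `Lebesgue ⊗ counting`: `∫ f d(labelSpace) = ∫ Σ_B f(Y, B) dY`. [folklore] -/
theorem lintegral_labelSpace {K : ℕ} {f : Config n × SubIdx K → ℝ≥0∞} (hf : Measurable f) :
    ∫⁻ ω, f ω ∂(labelSpace n K) = ∫⁻ Y, ∑ B : SubIdx K, f (Y, B) := by
  unfold labelSpace
  rw [lintegral_prod _ hf.aemeasurable]
  refine lintegral_congr fun Y => ?_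
  rw [lintegral_count, tsum_fintype]

/-- The joint label density has total mass `1` (block masses summing to `1`). [folklore] -/
theorem lintegral_labelJoint {L : ℝ} {K : ℕ} {Φ : Config (n + 1) → ℝ} (hΦm : Measurable Φ)
    (hmass : ∫⁻ Y, ∑ B : SubIdx K, blockMass L K Φ B Y = 1) :
    ∫⁻ ω, labelJoint L K Φ ω ∂(labelSpace n K) = 1 := by
  rw [lintegral_labelSpace (measurable_labelJoint L K hΦm)]
  exact hmass

/-- The reference label density has total mass `1` for a normalised `Φ`. [folklore] -/
theorem lintegral_labelRef {K : ℕ} (hK : 0 < K) {Φ : Config (n + 1) → ℝ} (hΦm : Measurable Φ)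
    (hΦ1 : ∫⁻ Y : Config n, ∫⁻ x, ENNReal.ofReal (Φ (Matrix.vecCons x Y)) ^ 2 = 1) :
    ∫⁻ ω, labelRef K Φ ω ∂(labelSpace n K) = 1 := by
  rw [lintegral_labelSpace (measurable_labelRef K hΦm)]
  have h : ∀ Y : Config n, ∑ B : SubIdx K, labelRef K Φ (Y, B) = sliceSq Φ Y := fun Y => by
    simp only [labelRef]
    rw [← Finset.mul_sum, sum_blockWeight_sq hK, mul_one]
  simp_rw [h]
  exact hΦ1

/-- `(q·(P·w²))^{1/2} = P^{1/2}·(w·q^{1/2})` in `ℝ≥0∞`. [folklore] -/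
theorem sqrt_joint_mul_ref (q P w : ℝ≥0∞) :
    (q * (P * w ^ 2)) ^ (1 / 2 : ℝ) = P ^ (1 / 2 : ℝ) * (w * q ^ (1 / 2 : ℝ)) := by
  have h : (0 : ℝ) ≤ 1 / 2 := by norm_num
  have rpow_half_sq : ∀ m : ℝ≥0∞, (m ^ 2) ^ (1 / 2 : ℝ) = m := fun m => by
    rw [← ENNReal.rpow_two, ← ENNReal.rpow_mul]; norm_num
  rw [ENNReal.mul_rpow_of_nonneg _ _ h, ENNReal.mul_rpow_of_nonneg _ _ h, rpow_half_sq]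
  ring

/-- **The label affinity is the Bhattacharyya coefficient of the joint law against `P̂ ⊗ unif`.**
[folklore] -/
theorem lintegral_sqrt_labelJoint_mul_labelRef (L : ℝ) (K : ℕ) {Φ : Config (n + 1) → ℝ}
    (hΦm : Measurable Φ) :
    ∫⁻ ω, (labelJoint L K Φ ω * labelRef K Φ ω) ^ (1 / 2 : ℝ) ∂(labelSpace n K) =
      labelAffinity L K Φ := by
  have hf : Measurable fun ω : Config n × SubIdx K =>
      (labelJoint L K Φ ω * labelRef K Φ ω) ^ (1 / 2 : ℝ) :=
    ((measurable_labelJoint L K hΦm).mul (measurable_labelRef K hΦm)).pow_const _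
  rw [lintegral_labelSpace hf]
  unfold labelAffinity
  refine lintegral_congr fun Y => ?_
  simp only [labelJoint, labelRef, sqrt_joint_mul_ref]
  rw [Finset.mul_sum]

/-- ★ **INFORMATION DOOR** (any scale): `KL(joint ‖ P̂ ⊗ unif) ≤ κ ⇒ labelAffinity ≥ e^{-κ/2}` — Jensen
(`D_{1/2} ≤ KL`, tree `exp_neg_div_two_le_lintegral_sqrt_of_klDiv_le`) on `Lebesgue ⊗ counting`, for a
normalised `Φ` whose block masses exhaust the slice (`∫ Σ_B q_B = 1`, e.g. `Φ` supported in the box).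
[cite: LSSY2005, §1.2 (1.17)] -/
theorem exp_neg_div_two_le_labelAffinity_of_labelKL_le {L : ℝ} {K : ℕ} (hK : 0 < K)
    {Φ : Config (n + 1) → ℝ} (hΦm : Measurable Φ)
    (hΦ1 : ∫⁻ Y : Config n, ∫⁻ x, ENNReal.ofReal (Φ (Matrix.vecCons x Y)) ^ 2 = 1)
    (hmass : ∫⁻ Y, ∑ B : SubIdx K, blockMass L K Φ B Y = 1) {κ : ℝ} (hκ0 : 0 ≤ κ)
    (hκ : labelKL L K Φ ≤ ENNReal.ofReal κ) :
    ENNReal.ofReal (Real.exp (-κ / 2)) ≤ labelAffinity L K Φ := by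
  rw [← lintegral_sqrt_labelJoint_mul_labelRef L K hΦm]
  exact exp_neg_div_two_le_lintegral_sqrt_of_klDiv_le (labelSpace n K) (measurable_labelRef K hΦm)
    (measurable_labelJoint L K hΦm) (lintegral_labelRef hK hΦm hΦ1) (lintegral_labelJoint hΦm hmass)
    hκ0 hκ

/-- The same door through the REVERSE entropy `KL(P̂ ⊗ unif ‖ joint) ≤ κ`. [cite: LSSY2005, §1.2 (1.17)] -/
theorem exp_neg_div_two_le_labelAffinity_of_labelKLRev_le {L : ℝ} {K : ℕ} (hK : 0 < K)
    {Φ : Config (n + 1) → ℝ} (hΦm : Measurable Φ)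
    (hΦ1 : ∫⁻ Y : Config n, ∫⁻ x, ENNReal.ofReal (Φ (Matrix.vecCons x Y)) ^ 2 = 1)
    (hmass : ∫⁻ Y, ∑ B : SubIdx K, blockMass L K Φ B Y = 1) {κ : ℝ} (hκ0 : 0 ≤ κ)
    (hκ : labelKLRev L K Φ ≤ ENNReal.ofReal κ) :
    ENNReal.ofReal (Real.exp (-κ / 2)) ≤ labelAffinity L K Φ := by
  rw [← lintegral_sqrt_labelJoint_mul_labelRef L K hΦm]
  exact exp_neg_div_two_le_lintegral_sqrt_of_klDiv_symm_le (labelSpace n K)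
    (measurable_labelRef K hΦm) (measurable_labelJoint L K hΦm) (lintegral_labelRef hK hΦm hΦ1)
    (lintegral_labelJoint hΦm hmass) hκ0 hκ

/-- **Block masses exhaust the slice** for an amplitude supported in the box: `Σ_B q_B(Y) = P̂(Y)`
(the `K³` sub-cells of side `L/K` partition `[0,L)³ ⊇ Λ_L`). [folklore] -/
theorem sum_blockMass_eq_sliceSq {L : ℝ} {K : ℕ} (hL : 0 < L) (hK : 0 < K)
    {Φ : Config (n + 1) → ℝ} (hΦm : Measurable Φ) (hΦz : ∀ X, X ∉ boxN (n + 1) L → Φ X = 0)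
    (Y : Config n) : ∑ B : SubIdx K, blockMass L K Φ B Y = sliceSq Φ Y := by
  have hKr : (0 : ℝ) < K := by exact_mod_cast hK
  have hℓ : 0 < L / (K : ℝ) := div_pos hL hKr
  have hkℓ : (K : ℝ) * (L / (K : ℝ)) = L := mul_div_cancel₀ L hKr.ne'
  have hfm : Measurable fun x : Space => ENNReal.ofReal (Φ (Matrix.vecCons x Y)) ^ 2 :=
    ((hΦm.comp (measurable_vecCons.comp (measurable_id.prodMk measurable_const))).ennreal_ofReal).pow_const 2
  have hsupp : Function.support (fun x : Space => ENNReal.ofReal (Φ (Matrix.vecCons x Y)) ^ 2) ⊆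
      cell ((K : ℝ) * (L / (K : ℝ))) := by
    intro x hx
    by_contra hxc
    apply hx
    have hbox : (Matrix.vecCons x Y : Config (n + 1)) ∉ boxN (n + 1) L := by
      intro h
      have h0 : x ∈ box L := by simpa using h 0
      rw [hkℓ] at hxc
      exact hxc fun i => ⟨(h0 i).1.le, (h0 i).2⟩
    simp [hΦz _ hbox]
  unfold blockMass sliceSq
  rw [sum_setLIntegral_subCell hℓ hfm.aemeasurable, setLIntegral_eq_of_support_subset hsupp]

/-! ### §11b  The TOLERANCE DOOR: fair share on a massive set of environments ⟹ label affinity -/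

/-- ★ **TOLERANCE (fair-share) DOOR** (any scale): if on a measurable set `G` of environments every
block carries at least `γ ×` its fair share `K⁻³ P̂(Y)` of particle 1's conditional mass
(`γ K⁻³ P̂(Y) ≤ q_B(Y)`, i.e. one-particle INSERTION TOLERANCE into every block at density cost `≤ γ⁻¹`),
then `labelAffinity ≥ √γ · P̂(G)` (pointwise `Σ_B √(π_B K⁻³) ≥ √γ Σ_B K⁻³ = √γ` on `G`). [folklore] -/
theorem labelAffinity_ge_of_fairShare {L : ℝ} {K : ℕ} (hK : 0 < K) {Φ : Config (n + 1) → ℝ}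
    {γ : ℝ} {G : Set (Config n)} (hG : MeasurableSet G)
    (hfair : ∀ Y ∈ G, ∀ B : SubIdx K,
      ENNReal.ofReal γ * (blockWeight K ^ 2 * sliceSq Φ Y) ≤ blockMass L K Φ B Y) :
    ENNReal.ofReal γ ^ (1 / 2 : ℝ) * ∫⁻ Y in G, sliceSq Φ Y ≤ labelAffinity L K Φ := by
  have h2 : (0 : ℝ) ≤ 1 / 2 := by norm_num
  have rpow_half_sq : ∀ m : ℝ≥0∞, (m ^ 2) ^ (1 / 2 : ℝ) = m := fun m => by
    rw [← ENNReal.rpow_two, ← ENNReal.rpow_mul]; norm_num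
  have sq_rpow_half : ∀ m : ℝ≥0∞, (m ^ (1 / 2 : ℝ)) ^ 2 = m := fun m => by
    rw [← ENNReal.rpow_two, ← ENNReal.rpow_mul]; norm_num
  set g : ℝ≥0∞ := ENNReal.ofReal γ ^ (1 / 2 : ℝ) with hgdef
  have hgtop : g ≠ ⊤ := ENNReal.rpow_ne_top_of_nonneg h2 ENNReal.ofReal_ne_top
  have hpt : ∀ Y ∈ G, g * sliceSq Φ Y ≤
      sliceSq Φ Y ^ (1 / 2 : ℝ) * ∑ B : SubIdx K, blockWeight K * blockMass L K Φ B Y ^ (1 / 2 : ℝ) := by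
    intro Y hY
    set p : ℝ≥0∞ := sliceSq Φ Y ^ (1 / 2 : ℝ) with hpdef
    have hB : ∀ B : SubIdx K, g * (blockWeight K * p) ≤ blockMass L K Φ B Y ^ (1 / 2 : ℝ) := by
      intro B
      have h := ENNReal.rpow_le_rpow (hfair Y hY B) h2
      rwa [ENNReal.mul_rpow_of_nonneg _ _ h2, ENNReal.mul_rpow_of_nonneg _ _ h2, rpow_half_sq] at h
    have hsum : ∑ B : SubIdx K, blockWeight K * (g * (blockWeight K * p)) = g * p := by
      rw [Finset.sum_congr rfl fun B _ => show blockWeight K * (g * (blockWeight K * p)) =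
        g * p * blockWeight K ^ 2 by ring, ← Finset.mul_sum, sum_blockWeight_sq hK, mul_one]
    calc g * sliceSq Φ Y = p * (g * p) := by
          conv_lhs => rw [← sq_rpow_half (sliceSq Φ Y)]
          ring
      _ = p * ∑ B : SubIdx K, blockWeight K * (g * (blockWeight K * p)) := by rw [hsum]
      _ ≤ p * ∑ B : SubIdx K, blockWeight K * blockMass L K Φ B Y ^ (1 / 2 : ℝ) := by
          gcongr with B _
          exact hB B
  calc g * ∫⁻ Y in G, sliceSq Φ Y = ∫⁻ Y in G, g * sliceSq Φ Y :=
        (lintegral_const_mul' _ _ hgtop).symm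
    _ ≤ ∫⁻ Y in G, sliceSq Φ Y ^ (1 / 2 : ℝ) *
          ∑ B : SubIdx K, blockWeight K * blockMass L K Φ B Y ^ (1 / 2 : ℝ) := setLIntegral_mono' hG hpt
    _ ≤ labelAffinity L K Φ := setLIntegral_le_lintegral _ _

end Summit.AtomisticToContinuum.BoseEinsteinCondensation.Theorems.BoxLabelAffinity

namespace Summit.AtomisticToContinuum.BoseEinsteinCondensation.Theorems.BoxHorizonAffinity

open MeasureTheory Filter Set InformationTheory
open scoped ENNReal NNReal BigOperators
open Literature.MathematicalPhysics.QuantumManyBody.BoseGas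
open Summit.AtomisticToContinuum.BoseEinsteinCondensation.Theorems.BoxLatticeFSum
open Summit.AtomisticToContinuum.BoseEinsteinCondensation.Theorems.BoxLabelAffinity

variable {n : ℕ}

/-! ### §12  The information piece HKL(η) (ATTACK LINE for the residual) and its kernel -/

/-- **HKL(η)** (ATTACK LINE · STRONGER than the residual LAB_h(η) · TAG UNDECIDED · information currency)
`GroundStateHorizonLabelKL η`: for `a > 0` there are `κ ≥ 0` and a horizon constant `M > 0` such that,
below a density cap and eventually in `N = n+1`, IF a nonnegative ground state exists, the conditional
HORIZON-cell relative entropy `E_{Y∼P̂} KL(π_h(·|Y) ‖ unif) = I(cell_h(x₁) ; Y) + KL(law(cell_h(x₁)) ‖ unif)`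
of `|Ψ₀|²` is `≤ κ` for every `K` in the horizon window.  By data processing this is the SMALLEST of the
one-vs-rest dependence functionals of the solo-blind line (`SoloBlindMutualInformation`), two scales
coarser than its wall «lemma M».  Why it might fail: number rigidity of `|Ψ₀|²` at scale `ℓ_h` would make
`π_h(·|Y)` a point mass (`KL = log K_h³ → ∞`); the bet (d = 3, `S(k) ∝ k`) is recorded in the header. -/
@[conjecture] def GroundStateHorizonLabelKL (η : ℝ≥0) : Prop :=
  ∀ v : ℝ → ℝ≥0∞, IsRepulsiveFiniteRange v → 0 < scatteringLength v →
    ∃ κ : ℝ, 0 ≤ κ ∧ ∃ M : ℝ, 0 < M ∧ ∃ ρ₀ : ℝ, 0 < ρ₀ ∧ ∀ ρ : ℝ, 0 < ρ → ρ < ρ₀ →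
      ∀ᶠ n : ℕ in atTop,
        (∃ Ψ₀ : Config (n + 1) → ℝ, (∀ X, 0 ≤ Ψ₀ X) ∧
          IsGroundState v (sideLength ρ (n + 1)) (fun X => (Ψ₀ X : ℂ))) →
        ∀ K : ℕ, 0 < K → InWindow (M * ρ ^ (-(η : ℝ))) ρ (sideLength ρ (n + 1)) K →
          labelKL (sideLength ρ (n + 1)) K (groundState v (n + 1) (sideLength ρ (n + 1))) ≤
            ENNReal.ofReal κ

/-- **HKL(η) ⟹ LAB_h(η)** with `c = e^{-κ/2}` (the information door run on the ground state, whose block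
masses exhaust the slice because it vanishes off the box). [folklore] -/
theorem horizonLabelAffinity_of_labelKL (η : ℝ≥0) (h : GroundStateHorizonLabelKL η) :
    GroundStateHorizonLabelAffinity η := by
  intro v hv ha
  obtain ⟨κ, hκ0, M, hM, ρ₀, hρ₀, h'⟩ := h v hv ha
  refine ⟨Real.exp (-κ / 2), Real.exp_pos _, M, hM, ρ₀, hρ₀, fun ρ hρ hρlt => ?_⟩
  have hA : 0 < M * ρ ^ (-(η : ℝ)) := mul_pos hM (Real.rpow_pos_of_pos hρ _)
  filter_upwards [h' ρ hρ hρlt] with n hn hex K hK hKw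
  set L := sideLength ρ (n + 1) with hLdef
  have hL : 0 < L := sideLength_pos_of_inWindow hA hρ hK hKw
  set Φ := groundState v (n + 1) L with hΦdef
  have hΦm : Measurable Φ := measurable_groundState v (n + 1) L
  have hΦ1 : ∫⁻ Y : Config n, ∫⁻ x, ENNReal.ofReal (Φ (Matrix.vecCons x Y)) ^ 2 = 1 := by
    rw [← lintegral_eq_lintegral_lintegral_vecCons (hΦm.ennreal_ofReal.pow_const 2)]
    exact lintegral_groundState_sq hex
  have hmass : ∫⁻ Y, ∑ B : SubIdx K, blockMass L K Φ B Y = 1 := by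
    rw [← hΦ1]
    exact lintegral_congr fun Y => sum_blockMass_eq_sliceSq hL hK hΦm
      (fun X hX => groundState_eq_zero_of_not_mem v hX) Y
  exact exp_neg_div_two_le_labelAffinity_of_labelKL_le hK hΦm hΦ1 hmass hκ0 (hn hex K hK hKw)

/-- **Door-free information kernel of gen 34**: `UGS → LOC_h(η) → HKL(η) → BoseEinsteinCondensation`.
[folklore] -/
theorem bec_of_horizonKL₀ (η : ℝ≥0) (hU : BoxGroundStateUniqueness)
    (hloc : GroundStateHorizonCondensation η) (hkl : GroundStateHorizonLabelKL η) :
    _root_.BoseEinsteinCondensation :=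
  bec_of_horizonAffinity₀ η hU hloc (horizonLabelAffinity_of_labelKL η hkl)

/-! ### §13  The tolerance piece FSH(η) (ATTACK LINE for the residual, fibre form) and its kernel -/

/-- **FSH(η)** (ATTACK LINE · STRONGER than the residual LAB_h(η) · TAG UNDECIDED · fibre / L^∞ form,
incomparable with HKL(η)) `GroundStateHorizonFairShare η` — «one-particle insertion tolerance at the
energy horizon»: for `a > 0` there are `γ > 0`, `m > 0` and a horizon constant `M > 0` such that, below a
density cap and eventually in `N = n+1`, IF a nonnegative ground state exists, then for every `K` in the
horizon window there is a measurable set `G` of environments `Y` of `P̂`-mass `≥ m` on which EVERY horizon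
cell carries at least `γ ×` its fair share of particle 1's conditional law: `γ K⁻³ P̂(Y) ≤ q_B(Y)` for all
`B` (given the other `N−1` particles, particle 1 may be inserted into ANY horizon cell at density cost
`≤ γ⁻¹`).  Negation mechanism: number rigidity of `|Ψ₀|²` at scale `ℓ_h` stable under one-point
deletion (d = 3, hyperuniform class — open in print, see the module header / card §13). -/
@[conjecture] def GroundStateHorizonFairShare (η : ℝ≥0) : Prop :=
  ∀ v : ℝ → ℝ≥0∞, IsRepulsiveFiniteRange v → 0 < scatteringLength v →
    ∃ γ : ℝ, 0 < γ ∧ ∃ m : ℝ, 0 < m ∧ ∃ M : ℝ, 0 < M ∧ ∃ ρ₀ : ℝ, 0 < ρ₀ ∧ ∀ ρ : ℝ, 0 < ρ → ρ < ρ₀ →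
      ∀ᶠ n : ℕ in atTop,
        (∃ Ψ₀ : Config (n + 1) → ℝ, (∀ X, 0 ≤ Ψ₀ X) ∧
          IsGroundState v (sideLength ρ (n + 1)) (fun X => (Ψ₀ X : ℂ))) →
        ∀ K : ℕ, 0 < K → InWindow (M * ρ ^ (-(η : ℝ))) ρ (sideLength ρ (n + 1)) K →
          ∃ G : Set (Config n), MeasurableSet G ∧
            ENNReal.ofReal m ≤
              ∫⁻ Y in G, sliceSq (groundState v (n + 1) (sideLength ρ (n + 1))) Y ∧
            ∀ Y ∈ G, ∀ B : SubIdx K,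
              ENNReal.ofReal γ * (blockWeight K ^ 2 *
                  sliceSq (groundState v (n + 1) (sideLength ρ (n + 1))) Y) ≤
                blockMass (sideLength ρ (n + 1)) K (groundState v (n + 1) (sideLength ρ (n + 1))) B Y

/-- **FSH(η) ⟹ LAB_h(η)** with `c = √γ · m` (the tolerance door on the ground state). [folklore] -/
theorem horizonLabelAffinity_of_fairShare (η : ℝ≥0) (h : GroundStateHorizonFairShare η) :
    GroundStateHorizonLabelAffinity η := by
  intro v hv ha
  obtain ⟨γ, hγ, m, hm, M, hM, ρ₀, hρ₀, h'⟩ := h v hv ha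
  refine ⟨γ ^ (1 / 2 : ℝ) * m, mul_pos (Real.rpow_pos_of_pos hγ _) hm, M, hM, ρ₀, hρ₀,
    fun ρ hρ hρlt => ?_⟩
  filter_upwards [h' ρ hρ hρlt] with n hn hex K hK hKw
  obtain ⟨G, hG, hmass, hfair⟩ := hn hex K hK hKw
  calc ENNReal.ofReal (γ ^ (1 / 2 : ℝ) * m)
      = ENNReal.ofReal γ ^ (1 / 2 : ℝ) * ENNReal.ofReal m := by
        rw [ENNReal.ofReal_mul (Real.rpow_nonneg hγ.le _), ENNReal.ofReal_rpow_of_pos hγ]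
    _ ≤ ENNReal.ofReal γ ^ (1 / 2 : ℝ) *
          ∫⁻ Y in G, sliceSq (groundState v (n + 1) (sideLength ρ (n + 1))) Y := by
        gcongr
    _ ≤ _ := labelAffinity_ge_of_fairShare hK hG hfair

/-- **Door-free tolerance kernel of gen 34**: `UGS → LOC_h(η) → FSH(η) → BoseEinsteinCondensation`.
[folklore] -/
theorem bec_of_horizonFairShare₀ (η : ℝ≥0) (hU : BoxGroundStateUniqueness)
    (hloc : GroundStateHorizonCondensation η) (hfs : GroundStateHorizonFairShare η) :
    _root_.BoseEinsteinCondensation :=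
  bec_of_horizonAffinity₀ η hU hloc (horizonLabelAffinity_of_fairShare η hfs)

end Summit.AtomisticToContinuum.BoseEinsteinCondensation.Theorems.BoxHorizonAffinity
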